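import Mathlib
import HarnessLib
import Summits.NavierStokesRegularity.NavierStokesRegularity.Theorems.UnthreadedDoorCellFluxDefs

/-!
# Route `UnthreadedDoor`, crux `PoloidalLiouville` (stmt-NavierStokesRegularity-1222), WALL W1 — crux idea «cell-flux» (ns-idea-14 g6,
# `Cruxes/PoloidalLiouville/CellFluxSketch.lean` v1.2): KERNEL GLUE of the Defs twin (`UnthreadedDoorCellFluxDefs`)

The sorry-free kernel facts of the custodian's Defs twin `Cruxes/PoloidalLiouville/CellFluxDefsTwin.lean` (b84b73dc23e6), split off the
statement-only file `UnthreadedDoorCellFluxDefs.lean` (gate rule: a Theorems file with proofs is ≤ 400 lines): by-name certificates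
(`nullTimeDenseFinite_holds` := p688761, `hh0` := p682567), the elementary implications between the strata / branches
(`denseFinite_of_nullTime`, `cellTameAnalytic_of_stratum`, `zonal_of_vanishes`, `analyticOrIrrotational_of`, `typeI_of_cellTame_of_residual`,
`typeI_of_branches`, `persistentSheet_of_typeI`) and the set algebra of cells on finite-critical spheres (`sheetTrace_eq_empty_of_finite`,
`cellSet_eq_of_sheetTrace_empty`, `clusterFlux_singleton`, `cellFlux_eq_netFlux_of_finite`, `cellSet_finite_ncard_of_finite`,
`nullTimeDenseFinite_of_cellTame`, `denseFinite_of_cellTame`).  Bodies VERBATIM from the twin; proposer ns-qj-p1 g5 (V22-P4 pick-up).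

HONEST LABEL: glue only — none of the chain's stubs (Σ-0…Σ-5a, Z, HH-0⁺) is proved here; K3^Σ, `ComplexSheetResidualTypeI`, `PoloidalLiouville`
(1222), W1 and the summit stay OPEN; NO Navier–Stokes regularity statement is proved.  `--supports stmt-NavierStokesRegularity-1222 --as helper`.  [folklore]
-/

noncomputable section

set_option linter.dupNamespace false
set_option linter.unusedVariables false

open Set Function Filter Topology MeasureTheory
open scoped RealInnerProductSpace

namespace Summit.NavierStokesRegularity.NavierStokesRegularity.Theorems.PoloidalLiouville.CellFlux

open Summit.NavierStokesRegularity.NavierStokesRegularity.Theorems.PoloidalLiouville.NetFlux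
  (E3 sphSup sphInf sphOsc netFlux IsUnimodalSphere CurledLaw sphArgmax sphArgmin radDeriv isPreconnected_sphere_diff_finite
   PersistentSheetResidualTypeI)
open Literature.Analysis Literature.Analysis.FluidPDE

/-- (by name) K3ᵃᵉ is LANDED: p688761 `NetFlux.nullTimeDenseFiniteZeroScalarLiouvilleTypeI_holds` has exactly this type. -/
theorem nullTimeDenseFinite_holds : NullTimeDenseFiniteZeroScalarLiouvilleTypeI :=
  Theorems.PoloidalLiouville.NetFlux.nullTimeDenseFiniteZeroScalarLiouvilleTypeI_holds

/-- (kernel) K3ᵃᵉ ⇒ K3ᶠ (`D = ∅`). -/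
theorem denseFinite_of_nullTime (h : NullTimeDenseFiniteZeroScalarLiouvilleTypeI) : DenseFiniteZeroScalarLiouvilleTypeI :=
  fun v x₀ T hC hB hm hsv hsT hTb hrep hE hd =>
    h v x₀ T hC hB hm hsv hsT hTb hrep hE ⟨∅, isClosed_empty, measure_empty, fun t ht _ => hd t ht⟩

/-- HH-0 by name (p682567). [folklore] -/
theorem hh0 : NSSpatialAnalyticity := Theorems.PoloidalLiouville.NetFlux.nsSpatialAnalyticity  -- CLOSED BY NAME p682567

/-- (kernel) the analytic form restricted to its per-time content is the stratum statement's shape: the stratum version implies it. -/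
theorem cellTameAnalytic_of_stratum
    (h : ∀ (N₀ : ℕ) (D : Set ℝ), IsClosed D → volume D = 0 → ScalarLiouvilleTypeIOn (cellPred N₀ D)) :
    CellTameAnalyticScalarLiouvilleTypeI :=
  fun N₀ D hDc hD0 v x₀ T hI hv hm hsv hsT hTb hlink hlaw _ _ hS => h N₀ D hDc hD0 v x₀ T hI hv hm hsv hsT hTb hlink hlaw hS

/-- (kernel) Z ⇒ the zonal Type-I scalar Liouville (the conclusion `∇T × (x − x₀) = ω = 0`). -/
theorem zonal_of_vanishes (h : ZonalUnthreadedVorticityVanishes) : ZonalTypeIScalarLiouville := by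
  intro v x₀ T _hC hB hm hsv _hsT _hTb hrep _hE hZ t ht x
  rw [← hrep t ht x]
  exact h v x₀ T hB hm hsv hrep hZ t ht x

/-- (kernel) Σ-5a + Z ⇒ analytic-in-frame or irrotational. -/
theorem analyticOrIrrotational_of (h₁ : UnthreadedGaugeRigidity) (h₂ : ZonalUnthreadedVorticityVanishes) :
    UnthreadedAnalyticOrIrrotational := by
  intro v x₀ T hB hm hsv hrep
  rcases h₁ v x₀ T hB hm hsv hrep with hA | hZ
  · exact Or.inl hA
  · exact Or.inr (h₂ v x₀ T hB hm hsv hrep hZ)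

/-- (kernel) **K3^Σ and its residual exhaust the Type-I half of W1.** -/
theorem typeI_of_cellTame_of_residual (h₁ : CellTameScalarLiouvilleTypeI) (h₂ : ComplexSheetResidualTypeI) :
    TypeIScalarLiouville := by
  intro v x₀ T hI hv hm hsv hsT hTb hlink hlaw
  by_cases hc : ∃ N₀ : ℕ, ∃ D : Set ℝ, IsClosed D ∧ volume D = 0 ∧ ∀ t < 0, t ∉ D →
      ∃ B : Set ℝ, IsClosed B ∧ volume B = 0 ∧ ∀ r, 0 < r → r ∉ B →
        (cellSet (T t) x₀ r).Finite ∧ (cellSet (T t) x₀ r).ncard ≤ N₀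
  · exact h₁ v x₀ T hI hv hm hsv hsT hTb hlink hlaw hc
  · exact h₂ v x₀ T hI hv hm hsv hsT hTb hlink hlaw hc

/-- (kernel, v1.1) **After the card the Type-I half of W1 splits along the rigidity dichotomy**: zonal flows by Σ-Z (`N₀`-free), the rest is the
ANALYTIC-FRAME class — so the live residual is `AnalyticFrameTypeIScalarLiouville` restricted to unbounded cell complexity. -/
theorem typeI_of_branches (h₁ : UnthreadedGaugeRigidity) (h₂ : ZonalTypeIScalarLiouville) (h₃ : AnalyticFrameTypeIScalarLiouville) :
    TypeIScalarLiouville := by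
  intro v x₀ T hC hB hm hsv hsT hTb hrep hE
  rcases h₁ v x₀ T hB hm hsv hrep with hA | hZ
  · exact h₃ v x₀ T hC hB hm hsv hsT hTb hrep hE hA
  · exact h₂ v x₀ T hC hB hm hsv hsT hTb hrep hE hZ

/-- (kernel) The residual of K3^Σ implies the residual of K3ᵃᵉ's chain (it asks for less). -/
theorem persistentSheet_of_typeI (h : TypeIScalarLiouville) : PersistentSheetResidualTypeI := by
  intro v x₀ T hI hv hm hsv hsT hTb hlink hlaw _ _
  exact h v x₀ T hI hv hm hsv hsT hTb hlink hlaw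

/-- (kernel) **A finite sphere-critical set has no sheet trace.** -/
theorem sheetTrace_eq_empty_of_finite {f : E3 → ℝ} {x₀ : E3} {r : ℝ} (h : (sphCrit f x₀ r).Finite) :
    sheetTrace f x₀ r = ∅ := by
  ext x
  simp only [sheetTrace, mem_setOf_eq, mem_empty_iff_false, iff_false, not_and]
  intro hx hacc
  rw [accPt_iff_frequently] at hacc
  have hcl : IsClosed (sphCrit f x₀ r \ {x}) := (h.subset fun y hy => hy.1).isClosed
  have hev : ∀ᶠ y in 𝓝 x, y ∉ sphCrit f x₀ r \ {x} :=
    hcl.isOpen_compl.mem_nhds (fun hx' => hx'.2 rfl)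
  exact hacc (hev.mono fun y hy hyC => hy ⟨hyC.2, hyC.1⟩)

/-- (kernel) **No sheet trace ⇒ exactly one cell, the sphere** (`r > 0`; the sphere of `ℝ³` is preconnected — the landed
`isPreconnected_sphere_diff_finite` with `F = ∅`). -/
theorem cellSet_eq_of_sheetTrace_empty {f : E3 → ℝ} {x₀ : E3} {r : ℝ} (hr : 0 < r) (h : sheetTrace f x₀ r = ∅) :
    cellSet f x₀ r = {Metric.sphere x₀ r} := by
  have hpc : IsPreconnected (Metric.sphere x₀ r) := by
    simpa using isPreconnected_sphere_diff_finite x₀ hr Set.finite_empty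
  have hne : (Metric.sphere x₀ r).Nonempty := (NormedSpace.sphere_nonempty).2 hr.le
  simp only [cellSet, cellOf, h, Set.sdiff_empty]
  refine Set.eq_singleton_iff_nonempty_unique_mem.2 ⟨hne.image _, ?_⟩
  rintro K ⟨x, hx, rfl⟩
  exact Subset.antisymm (connectedComponentIn_subset _ _) (hpc.subset_connectedComponentIn hx Subset.rfl)

/-- (kernel) On a one-class family the cluster flux is `r · osc`. -/
theorem clusterFlux_singleton (f : E3 → ℝ) (r : ℝ) (S : Set E3) : clusterFlux f r {S} = r * setOsc f S := by
  simp [clusterFlux]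

/-- (kernel) **`cellFlux = netFlux` on finite-crit spheres** — the cell flux EXTENDS the netflux functional of K3ᵘ/K3ᶠ/K3ᵃᵉ. -/
theorem cellFlux_eq_netFlux_of_finite {f : E3 → ℝ} {x₀ : E3} {r : ℝ} (hr : 0 < r) (h : (sphCrit f x₀ r).Finite) :
    cellFlux f x₀ r = netFlux f x₀ r := by
  rw [cellFlux, cellSet_eq_of_sheetTrace_empty hr (sheetTrace_eq_empty_of_finite h), clusterFlux_singleton]
  rfl

/-- (kernel) **Finite-crit spheres are cell-tame with complexity 1.** -/
theorem cellSet_finite_ncard_of_finite {f : E3 → ℝ} {x₀ : E3} {r : ℝ} (hr : 0 < r) (h : (sphCrit f x₀ r).Finite) :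
    (cellSet f x₀ r).Finite ∧ (cellSet f x₀ r).ncard ≤ 1 := by
  rw [cellSet_eq_of_sheetTrace_empty hr (sheetTrace_eq_empty_of_finite h)]
  exact ⟨Set.finite_singleton _, by simp⟩

/-- (kernel) **CONTAINMENT K3^Σ ⊇ K3ᵃᵉ ⊇ K3ᶠ** modulo the analytic-geometry support Σ-0d and HH-0: the cell-tame Liouville implies the null-time
dense-finite-zero Liouville (hence, by the landed `denseFinite_of_nullTime`, K3ᶠ). -/
theorem nullTimeDenseFinite_of_cellTame (h : CellTameScalarLiouvilleTypeI) (hS : SheetRadiiNull) (h0 : NSSpatialAnalyticity) :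
    NullTimeDenseFiniteZeroScalarLiouvilleTypeI := by
  intro v x₀ T hI hv hm hsv hsT hTb hlink hlaw hD
  obtain ⟨D, hDc, hD0, hDt⟩ := hD
  refine h v x₀ T hI hv hm hsv hsT hTb hlink hlaw ⟨1, D, hDc, hD0, fun t ht htD => ?_⟩
  -- the slice of `T` at time `t` is `C¹` off the centre
  have hTs : ContDiffOn ℝ 1 (T t) ({x₀}ᶜ : Set E3) := by
    have hc : ContDiffOn ℝ (⊤ : ℕ∞) (uncurry T ∘ fun x : E3 => (t, x)) ({x₀}ᶜ : Set E3) :=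
      hsT.comp ((contDiff_prodMk_right t).contDiffOn (s := ({x₀}ᶜ : Set E3))) (fun x hx => ⟨ht, hx⟩)
    exact hc.of_le (by exact_mod_cast le_top)
  obtain ⟨B, hBc, hB0, hB⟩ := hS (v t) x₀ (T t) (h0 v hv hm hsv t ht) hTs (hlink t ht) (hDt t ht htD)
  exact ⟨B, hBc, hB0, fun r hr hrB => cellSet_finite_ncard_of_finite hr (hB r hr hrB)⟩

/-- K3^Σ + sheet-radii-null + HH-0 ⇒ K3ᶠ (through K3ᵃᵉ). [folklore] -/
theorem denseFinite_of_cellTame (h : CellTameScalarLiouvilleTypeI) (hS : SheetRadiiNull) (h0 : NSSpatialAnalyticity) :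
    DenseFiniteZeroScalarLiouvilleTypeI :=
  denseFinite_of_nullTime (nullTimeDenseFinite_of_cellTame h hS h0)

end Summit.NavierStokesRegularity.NavierStokesRegularity.Theorems.PoloidalLiouville.CellFlux

end
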